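import Summits.ABC.IUTFork.Joshi.ATS4DescentSpine
import Summits.ABC.IUTFork.Joshi.ATS4RamificationDivisorsPrimes
import Summits.ABC.IUTFork.Joshi.ATS4MainBoundsThetaTower
import Literature.IUT.LogVolume.DistinguishedPrimesBoundTower
import HarnessLib

/-!
# [J-IV] (arXiv:2403.10430v2) §6.6–§6.7 / §6.11: the rows (6.11.1) `Eq6111` and «component sums» `ComponentSums` of the E5
# spine AT GENUINE READINGS — support statements, and Lemma 6.7.1 (2) ⟹ (3) PROVED on the theta-division tower

Proof-only companion (0 defs) of the abc-iut cell, R-J «Joshi Y-discharge census» rows **Y-21c** (`LocusVolumeDatum.Eq6111`)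
and **Y-21e** (`LocusVolumeDatum.ComponentSums`) (rung LADDER-ABC:A2.RESCUE.J), seat abc-iut-E-t35 (gen 6; lineage: the
calibration `Joshi/ATS4DescentInputsCalibration.lean` p446138). SOURCE: K. Joshi, *Construction of Arithmetic Teichmüller Spaces
IV*, arXiv:2403.10430v2 (unrefereed; bib `Joshi2024ATS4`): §6.6 p.60 l.56–62 («v ∈ V^dst_M iff v extends to a prime of L′ which
is ramified over ℚ»), Lemma 6.7.1 p.61 l.20–30 («(1) v_ℚ ∈ V^dst_ℚ (2) v_ℚ ramifies in L′ (3) v_ℚ divides 30·ℓ or v_ℚ is in the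
image of Supp(q_{L_tpd} + d_{L_tpd}) (4) … Supp(q_L + d_L)»), (6.7.2)–(6.7.7) p.61 l.31–p.62 l.21, (6.11.1) p.69 l.73–p.70 l.3
(«with primes v_ℚ ∉ V^dst_ℚ ∪ {∞} contributing a zero by Proposition 6.10.10»), p.70 l.4–29; [J-III] (arXiv:2401.13508v4) p.128
l.2–8 («−|LogVol(Θ̃^𝓘)| = Σ_p −|LogVol(Θ̃_p)|»). Page/line = the cell's render `HOME/lit/renders/Joshi-arxiv-2403.10430/`.
FRAMING (binding): finite-support bookkeeping and classical ramification theory (Dedekind) composed with the tree's PROVED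
unramifiedness of the genuine theta-division tower. NO side is taken on [IUTchIII] Cor. 3.12 / [IUTchIV] Thm. 1.10, on Joshi's
claims or on Mochizuki's report on them; NOT a test verdict; NO abc claim. Typed ≠ proved ≠ endorsed.

WHAT THE TWO ROWS ARE AT GENUINE READINGS. In E-t31's carrier (p430311) `V^dst_ℚ` and every `v_ℚ`-component are FREE slots (on the
free carrier no letter has content alone: p446138, p451846). Read genuinely — `p`-component of `log(d_{L′})` := `(1/[L′:ℚ])·Σ_{u|p}
ord_u(𝔡_{L′})·log N(u)`; of `log(q)` := the `p`-part of the Tate divisor's normalized degree (T-26 `TateDivisorDatum`); of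
`log(s_ℚ)`, `log(s^≤_ℚ)` := E-t31's (6.7.2)/(6.7.6) objects (`TowerGlue`); of the hull log-volume := the per-`p` bundle
`Σ_{w ∈ W, p_w = p} |log Vol(Θ̃_w)|` of E-t4's `W`-indexed volumes under `DescentGlue` ([J-III] (9.10.4.1)); archimedean slot `0` —
(e) `ComponentSums` ⟸ «every prime ramified in `L′` and every prime under `Supp(q_L)` lies in `V^dst_ℚ`» (§2 `componentSums_of_genuine`;
sharp forms `sum_fiber_residueChar_eq_iff`, `degF_tateDivisor_eq_sum_fibers_iff`); (c) `Eq6111` ⟺ «every `w ∈ W` with `p_w ∉ V^dst_ℚ`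
has `log Vol(Θ̃_w) = 0`» (§2 `eq6111_iff_of_genuine`; HOLDS once the residue characteristics of `W ⊆ Supp(q)` lie in `V^dst_ℚ`).
Both rows are SUPPORT STATEMENTS about `V^dst_ℚ`. §3 proves on the genuine tower `F_tpd = ℚ(λ) ⊆ F` (theta field) `⊆ K` (Galois
over `F` inside `F(E_F[ℓ])`) **Lemma 6.7.1 (2) ⟹ (3)**: a prime under a place of `K` ramified over `ℚ` divides `30·ℓ`, or lies under
`Supp(𝔮_{F_tpd})`, or divides `disc(F_tpd)` (`GenuineVdst.residueChar_mem_of_ramified`, from the tree's (D0) descent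
`ramified_place_descends_of_not_dvd` fed with `ThetaTower.hKunr` / `ThetaTower.hFunr`, and Dedekind via Mathlib's
`NumberField.not_dvd_discr_iff_isUnramifiedIn`). Hence with `V^dst_ℚ` READ BY Lemma 6.7.1 (3) — `primeFactors(30ℓ) ∪ p(Supp 𝔮_{F_tpd})
∪ primeFactors(disc F_tpd)` — BOTH ROWS ARE DERIVED at the tower (§4 `componentSums_thetaTower`, `eq6111_thetaTower`); read by the
§6.6 DEFINITION (= (1)/(2), `primeFactors(disc K)`) the `d_{L′}`-conjunct is derived and the support inclusions for `q` and `W` are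
EXACTLY Joshi's Lemma 6.7.1 (4) ⟹ (2) «a bad prime ramifies in L′», kept BY NAME (`componentSums_of_genuine_defn`, hypothesis `h412`;
the tree proves it in [IUTchI] Def. 3.1 currency, `ThetaData.one_lt_absRamificationIdx_of_under_mem_VFbad` — not bridged here).
Theorems only; standard axioms; no `sorry`, instance, notation, `def` or new `Prop`. [claim: Joshi2024ATS4, status: disputed].
-/

noncomputable section

open Finset NumberField IsDedekindDomain
open Literature.IUT.LogVolume Literature.IUT.LogVolume.Cor22
open Literature.NumberTheory.DiophantineGeometry.GenEll

namespace Summit.ABC.IUTFork.Joshi.ATS4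

/-! ## 1. Finite-support bookkeeping over one number field: sums of `v_ℚ`-components over `V^dst_ℚ` -/

section Bookkeeping

variable {M : Type*} [Field M] [NumberField M]

omit [NumberField M] in
/-- Regrouping a sum over a finite set of places by residue characteristic: if every place of `D` has residue characteristic
in `V^dst_ℚ`, the sum over `p ∈ V^dst_ℚ` of the `p`-fibres is the whole sum (p.70 l.4–29, the passage from Prop. 6.10.9 summed
over `V^dst_ℚ` to (6.11.2)). [folklore] -/
theorem sum_fiber_residueChar_eq (D : Finset (HeightOneSpectrum (𝓞 M))) (Vdst : Finset ℕ)
    (f : HeightOneSpectrum (𝓞 M) → ℝ) (h : ∀ u ∈ D, residueChar M u ∈ Vdst) :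
    ∑ p ∈ Vdst, ∑ u ∈ D with residueChar M u = p, f u = ∑ u ∈ D, f u :=
  Finset.sum_fiberwise_of_maps_to h f

omit [NumberField M] in
/-- The sharp form for nonnegative terms: the regrouped sum over `V^dst_ℚ` equals the whole sum IFF every place carrying a
nonzero term has residue characteristic in `V^dst_ℚ`. [folklore] -/
theorem sum_fiber_residueChar_eq_iff (D : Finset (HeightOneSpectrum (𝓞 M))) (Vdst : Finset ℕ)
    (f : HeightOneSpectrum (𝓞 M) → ℝ) (hf : ∀ u ∈ D, 0 ≤ f u) :
    ∑ p ∈ Vdst, ∑ u ∈ D with residueChar M u = p, f u = ∑ u ∈ D, f u ↔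
      ∀ u ∈ D, f u ≠ 0 → residueChar M u ∈ Vdst := by
  rw [Finset.sum_fiberwise_eq_sum_filter,
    ← Finset.sum_filter_add_sum_filter_not D (fun u => residueChar M u ∈ Vdst) f]
  constructor
  · intro h u hu hfu
    by_contra hnot
    have hzero : ∑ u ∈ D with ¬ residueChar M u ∈ Vdst, f u = 0 := by linarith
    rw [Finset.sum_eq_zero_iff_of_nonneg (fun v hv => hf v (Finset.mem_filter.mp hv).1)] at hzero
    exact hfu (hzero u (Finset.mem_filter.mpr ⟨hu, hnot⟩))
  · intro h
    have hzero : ∑ u ∈ D with ¬ residueChar M u ∈ Vdst, f u = 0 :=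
      Finset.sum_eq_zero fun u hu => by
        obtain ⟨huD, hnot⟩ := Finset.mem_filter.mp hu
        by_contra hne
        exact hnot (h u huD hne)
    rw [hzero, add_zero]

variable (M) in
/-- **The `d`-component sum**: for any finite set `V^dst_ℚ` of rational primes containing the residue characteristic of every
place of `M` ramified over `ℚ`, `Σ_{p ∈ V^dst_ℚ} Σ_{u | p} ord_u(𝔡_M)·log N(u) = deg(𝔡_M)` — the different is supported on the
ramified places (Dedekind: `ord_u 𝔡 > 0 ⟹ e(u|p) ≥ 2`, the tree's `two_le_ramificationIdx_int_of_multiplicity_pos`). `D` is any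
finite set of places containing `Supp(𝔡_M)`. [cite: NeukirchANT1999, Ch. III (2.6)] -/
theorem degF_differentDivisor_eq_sum_fibers (D : Finset (HeightOneSpectrum (𝓞 M)))
    (hD : ∀ u, differentDivisor M (Sum.inr u) ≠ 0 → u ∈ D) (Vdst : Finset ℕ)
    (hram : ∀ u : HeightOneSpectrum (𝓞 M), 2 ≤ u.asIdeal.ramificationIdx ℤ → residueChar M u ∈ Vdst) :
    ∑ p ∈ Vdst, ∑ u ∈ D with residueChar M u = p, differentDivisor M (Sum.inr u) * logNorm M u =
      degF M (differentDivisor M) := by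
  rw [degF_eq_sum_of_subset M (differentDivisor M) D (fun w => ADivisor.ofIdeal_apply_inl _ w) hD,
    Finset.sum_fiberwise_eq_sum_filter]
  refine Finset.sum_filter_of_ne fun u _ hne => hram u ?_
  have hd : differentDivisor M (Sum.inr u) ≠ 0 := fun h => hne (by rw [h, zero_mul])
  rw [differentDivisor_apply_inr] at hd
  exact two_le_ramificationIdx_int_of_multiplicity_pos u (Nat.pos_of_ne_zero fun h => hd (by rw [h, Nat.cast_zero]))

/-- **The `q`-component sum**: for a Tate-divisor datum `𝔮_M` (T-26, Def. 4.4.2) and any finite `V^dst_ℚ` containing the residue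
characteristics of `Supp(𝔮_M)`, `Σ_{p ∈ V^dst_ℚ} Σ_{w | p} ord_w(q_w)·log N(w) = deg(𝔮_M)`. [folklore] -/
theorem degF_tateDivisor_eq_sum_fibers (𝔮 : TateDivisorDatum M) (Vdst : Finset ℕ)
    (hV : ∀ w ∈ 𝔮.V, residueChar M w ∈ Vdst) :
    ∑ p ∈ Vdst, ∑ w ∈ 𝔮.V with residueChar M w = p, 𝔮.tateDivisor (Sum.inr w) * logNorm M w = degF M 𝔮.tateDivisor := by
  rw [degF_eq_sum_of_subset M 𝔮.tateDivisor 𝔮.V 𝔮.tateDivisor_apply_inl (fun w hw => by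
      rw [𝔮.tateDivisor_apply_inr] at hw
      by_contra h
      exact hw (if_neg h))]
  exact sum_fiber_residueChar_eq 𝔮.V Vdst _ hV

/-- **The `q`-component sum, sharp form**: the regrouped sum IS `deg(𝔮_M)` iff EVERY place of `Supp(𝔮_M)` has residue
characteristic in `V^dst_ℚ` (`ord_w(q_w) ≥ 1`, `log N(w) > 0`). [folklore] -/
theorem degF_tateDivisor_eq_sum_fibers_iff (𝔮 : TateDivisorDatum M) (Vdst : Finset ℕ) :
    ∑ p ∈ Vdst, ∑ w ∈ 𝔮.V with residueChar M w = p, 𝔮.tateDivisor (Sum.inr w) * logNorm M w = degF M 𝔮.tateDivisor ↔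
      ∀ w ∈ 𝔮.V, residueChar M w ∈ Vdst := by
  rw [degF_eq_sum_of_subset M 𝔮.tateDivisor 𝔮.V 𝔮.tateDivisor_apply_inl (fun w hw => by
      rw [𝔮.tateDivisor_apply_inr] at hw
      by_contra h
      exact hw (if_neg h)),
    sum_fiber_residueChar_eq_iff 𝔮.V Vdst _ (fun w hw => by
      rw [𝔮.tateDivisor_apply_inr, if_pos hw]
      exact mul_nonneg (Nat.cast_nonneg _) (logNorm_pos M w).le)]
  refine ⟨fun h w hw => h w hw ?_, fun h w hw _ => h w hw⟩
  rw [𝔮.tateDivisor_apply_inr, if_pos hw]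
  exact mul_ne_zero (by exact_mod_cast (𝔮.ordq_pos w hw).ne') (logNorm_pos M w).ne'

end Bookkeeping

/-! ## 2. The two rows of E-t31's carrier at genuine readings -/

namespace LocusVolumeDatum

variable (d : LocusVolumeDatum)

/-- **Row Y-21e, `ComponentSums`, at genuine readings.** Let the carrier's `V^dst_ℚ`, `log(d_{L′})`, `log(q)`, `log(s_ℚ)`,
`log(s^≤_ℚ)` and their `v_ℚ`-components be read genuinely: `log(s)`-objects := E-t31's (6.7.2)/(6.7.6) objects (`TowerGlue`),
`log(d_{L′}) := log(d_K)` (T-26 `logDifferent`) with `p`-component `(1/[K:ℚ])·Σ_{u ∈ D, p_u = p} ord_u(𝔡_K)·log N(u)` (`D ⊇ Supp(𝔡_K)`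
any finite set of places), `log(q) := log(𝔮_L)` of a Tate-divisor datum with `p`-component `(1/[L:ℚ])·Σ_{w ∈ Supp(𝔮_L), p_w = p}
ord_w(q_w)·log N(w)`. If `V^dst_ℚ` contains (i) the residue characteristic of every place of `K` ramified over `ℚ` (TRUE BY
DEFINITION under §6.6's `V^dst`) and (ii) that of every place of `Supp(𝔮_L)` (Lemma 6.7.1 (4) ⟹ (1); TRUE BY DEFINITION under
reading (3)/(4)), then `ComponentSums` holds. PROVED. [claim: Joshi2024ATS4, status: disputed] -/
theorem componentSums_of_genuine {T : PrimeTowerDatum} (GT : PrimeTowerDatum.TowerGlue T d)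
    {K : Type*} [Field K] [NumberField K] {L : Type*} [Field L] [NumberField L] (𝔮 : TateDivisorDatum L)
    (D : Finset (HeightOneSpectrum (𝓞 K))) (hD : ∀ u, differentDivisor K (Sum.inr u) ≠ 0 → u ∈ D)
    (hram : ∀ u : HeightOneSpectrum (𝓞 K), 2 ≤ u.asIdeal.ramificationIdx ℤ → residueChar K u ∈ d.Vdst)
    (hbad : ∀ w ∈ 𝔮.V, residueChar L w ∈ d.Vdst)
    (hDiff : d.logDiffLp = logDifferent K)
    (hDiffAt : ∀ p ∈ d.Vdst, d.logDiffLpAt p =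
      (Module.finrank ℚ K : ℝ)⁻¹ * ∑ u ∈ D with residueChar K u = p, differentDivisor K (Sum.inr u) * logNorm K u)
    (hq : d.logq = 𝔮.logq)
    (hqAt : ∀ p ∈ d.Vdst, d.logqAt p =
      (Module.finrank ℚ L : ℝ)⁻¹ * ∑ w ∈ 𝔮.V with residueChar L w = p, 𝔮.tateDivisor (Sum.inr w) * logNorm L w) :
    d.ComponentSums := by
  rw [GT.componentSums_iff]
  constructor
  · rw [Finset.sum_congr rfl hDiffAt, ← Finset.mul_sum, degF_differentDivisor_eq_sum_fibers K D hD d.Vdst hram, hDiff,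
      logDifferent, ndeg_apply, div_eq_inv_mul]
  · rw [Finset.sum_congr rfl hqAt, ← Finset.mul_sum, degF_tateDivisor_eq_sum_fibers 𝔮 d.Vdst hbad, hq,
      TateDivisorDatum.logq, ndeg_apply, div_eq_inv_mul]

variable {lstar : ℕ} {W : Type} [Fintype W] {D : SecondMainBoundDatum lstar W}

/-- **Row Y-21c, (6.11.1) `Eq6111`, at genuine readings — sharp form.** Under E-t31's `DescentGlue` the global hull log-volume of
the carrier is E-t4's `Σ_{w ∈ W} |log Vol(Θ̃_w)|` ([J-III] p.128 l.2–8); read the `p`-local hull log-volume as the per-`p` bundle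
`Σ_{w ∈ W, p_w = p} |log Vol(Θ̃_w)|` ((9.10.4.1); `χ` = residue characteristic of the places `w`) and the archimedean slot as `0`.
Then (6.11.1) holds IFF every `w ∈ W` whose residue characteristic is NOT in `V^dst_ℚ` has `log Vol(Θ̃_w) = 0` — the content
print assigns to Prop. 6.10.10 («contributing a zero», p.69 l.76). PROVED. [claim: Joshi2024ATS4, status: disputed] -/
theorem eq6111_iff_of_genuine (G : DescentGlue D d) (χ : W → ℕ)
    (hAt : ∀ p ∈ d.Vdst, d.logVolAt p = ∑ w ∈ Finset.univ with χ w = p, |Real.log (D.std.loc w).hullVol|)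
    (hArch : d.logVolArch = 0) :
    d.Eq6111 ↔ ∀ w, χ w ∉ d.Vdst → Real.log (D.std.loc w).hullVol = 0 := by
  have hls : 0 < d.lstar := d.lstar_pos
  have hc : -(1 / d.lstar) ≠ 0 := neg_ne_zero.mpr (one_div_pos.mpr hls).ne'
  have habs : ∀ p ∈ d.Vdst, |d.logVolAt p| = ∑ w ∈ Finset.univ with χ w = p, |Real.log (D.std.loc w).hullVol| :=
    fun p hp => by rw [hAt p hp]; exact abs_of_nonneg (Finset.sum_nonneg fun w _ => abs_nonneg _)
  unfold Eq6111
  rw [G.absLogVol_eq, hArch, abs_zero, add_zero, Finset.sum_congr rfl habs, Finset.sum_fiberwise_eq_sum_filter,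
    mul_right_inj' hc, ATS3.AdelicLocusDatum.absLogVol,
    ← Finset.sum_filter_add_sum_filter_not Finset.univ (fun w => χ w ∈ d.Vdst)]
  constructor
  · intro h w hw
    have hzero : ∑ w ∈ Finset.univ with ¬ χ w ∈ d.Vdst, |Real.log (D.std.loc w).hullVol| = 0 := by linarith
    rw [Finset.sum_eq_zero_iff_of_nonneg (fun v _ => abs_nonneg _)] at hzero
    exact abs_eq_zero.mp (hzero w (Finset.mem_filter.mpr ⟨Finset.mem_univ _, hw⟩))
  · intro h
    have hzero : ∑ w ∈ Finset.univ with ¬ χ w ∈ d.Vdst, |Real.log (D.std.loc w).hullVol| = 0 :=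
      Finset.sum_eq_zero fun w hw => abs_eq_zero.mpr (h w (Finset.mem_filter.mp hw).2)
    rw [hzero, add_zero]

/-- **Row Y-21c, `Eq6111`, at genuine readings**: (6.11.1) HOLDS as soon as every `w ∈ W` has residue characteristic in
`V^dst_ℚ` — TRUE BY DEFINITION under reading (3)/(4) (`W ⊆ Supp(q)`), Lemma 6.7.1 (4) ⟹ (2) under §6.6's definition. PROVED.
[claim: Joshi2024ATS4, status: disputed] -/
theorem eq6111_of_genuine (G : DescentGlue D d) (χ : W → ℕ) (hχ : ∀ w, χ w ∈ d.Vdst)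
    (hAt : ∀ p ∈ d.Vdst, d.logVolAt p = ∑ w ∈ Finset.univ with χ w = p, |Real.log (D.std.loc w).hullVol|)
    (hArch : d.logVolArch = 0) : d.Eq6111 :=
  (d.eq6111_iff_of_genuine G χ hAt hArch).2 fun w hw => absurd (hχ w) hw

end LocusVolumeDatum

/-! ## 3. Lemma 6.7.1 (2) ⟹ (3) on the genuine theta-division tower -/

namespace GenuineVdst

variable {P : NFPoint} {F : Type} [Field F] [NumberField F] [Algebra P.F F]
variable {K : Type} [Field K] [NumberField K] [Algebra F K] (ψ : K →ₐ[F] AlgebraicClosure F)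

/-- Dedekind's criterion, absolute form: a place of a number field ramified over `ℚ` lies over a prime dividing the discriminant
(Mathlib `NumberField.not_dvd_discr_iff_isUnramifiedIn`). [cite: NeukirchANT1999, Ch. III (2.12)] -/
theorem residueChar_dvd_discr_of_two_le_ramificationIdx {L : Type*} [Field L] [NumberField L]
    (v : HeightOneSpectrum (𝓞 L)) (h : 2 ≤ v.asIdeal.ramificationIdx ℤ) : ((residueChar L v : ℕ) : ℤ) ∣ discr L := by
  by_contra hnd
  have hp : (residueChar L v).Prime := residueChar_prime L v
  have hunr := (NumberField.not_dvd_discr_iff_isUnramifiedIn L (𝓞 L) (Nat.prime_iff_prime_int.mp hp)).mp hnd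
  have h1 : v.asIdeal.ramificationIdx ℤ = 1 := hunr.ramificationIdx_eq_one (liesOver_residueChar L v)
  omega

/-- The same as membership in `primeFactors(disc L)` — the `Finset` form of «ramifies in `L`». [cite: NeukirchANT1999, Ch. III (2.12)] -/
theorem residueChar_mem_primeFactors_discr {L : Type*} [Field L] [NumberField L]
    (v : HeightOneSpectrum (𝓞 L)) (h : 2 ≤ v.asIdeal.ramificationIdx ℤ) :
    residueChar L v ∈ (discr L).natAbs.primeFactors :=
  Nat.mem_primeFactors.mpr ⟨residueChar_prime L v,
    Int.natCast_dvd.mp (residueChar_dvd_discr_of_two_le_ramificationIdx v h),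
    Int.natAbs_ne_zero.mpr (discr_ne_zero L)⟩

variable [Algebra P.F K] [IsScalarTower P.F F K]

/-- **(D0) ⟹ (D5) on the genuine theta-division tower** `F_tpd = ℚ(λ) ⊆ F ⊆ K`: `λ ∈ U_X`, `F` a theta field of `λ`, `K/F` Galois
inside `F(E_F[ℓ])` (`ker ρ̄_{E_F,ℓ} ≤ Gal(F̄/ψK)`), `ℓ` prime, `𝔮_{F_tpd}` any Tate-divisor datum whose support CONTAINS the bad places
of `λ`. A place `u` of `K` ramified over `ℚ` with `p_u ∤ 2·3·5·ℓ` lies over a place of `F_tpd` in `Supp(𝔮_{F_tpd})` or ramified over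
`ℚ` — the tree's `ramified_place_descends_of_not_dvd` fed with `ThetaTower.hKunr` (`K/F` unramified at `p ≠ ℓ` off the bad places)
and `ThetaTower.hFunr` (`F/F_tpd` unramified at `p ∉ {2,3,5}` off the bad places). PROVED.
[cite: Mochizuki2012, IUTchIV Thm 1.10 proof Step (iii) (D0) p.26] [claim: Joshi2024ATS4, status: disputed] -/
theorem ramified_descends (hU : P.InU) (hF : IsThetaField P F) [IsGalois F K] {ℓ : ℕ} (hℓ : ℓ.Prime)
    (hK : letI := thetaCurve_isElliptic hU F
      ((thetaCurve P F).galoisRepTorsion (ℓ : ℤ)).ker ≤ ψ.fieldRange.fixingSubgroup)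
    {𝔮tpd : TateDivisorDatum P.F}
    (hsupp : ∀ v ∈ badPlaces P, residueChar P.F v ∉ ({2, 3, 5, ℓ} : Finset ℕ) → v ∈ 𝔮tpd.V)
    (u : HeightOneSpectrum (𝓞 K)) (hram : 2 ≤ u.asIdeal.ramificationIdx ℤ) (hp : ¬ residueChar K u ∣ 2 * 3 * 5 * ℓ) :
    finBelow P.F K u ∈ 𝔮tpd.V ∨ 2 ≤ (finBelow P.F K u).asIdeal.ramificationIdx ℤ := by
  refine ramified_place_descends_of_not_dvd P.F F K 𝔮tpd.V (fun u hu hV => ?_) (fun w hw hV => ?_) u hram hp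
  · refine ThetaTower.hKunr ψ hU hF hℓ hK u (fun h => hu (by simp [h])) ?_
    rw [finBelow_finBelow]
    exact fun hb => hV (hsupp _ hb (by rwa [residueChar_finBelow]))
  · refine ThetaTower.hFunr hU hF w (fun h => hw ?_) (fun hb => hV (hsupp _ hb (by rwa [residueChar_finBelow])))
    simp only [Finset.mem_insert, Finset.mem_singleton] at h ⊢
    tauto

/-- **Joshi's own data satisfy the support hypothesis of `ramified_descends`**: for `S ⊆ {2, 3, 5, ℓ}` a set of primes, T-26's
`𝔮_{F_tpd} := TateDivisorDatum.ofNFPoint λ S` (the bad places of `λ` not over a prime of `S`; Joshi's `q` avoids `{2, ℓ}`, E-t30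
p440894) contains every bad place of residue characteristic `∉ {2, 3, 5, ℓ}` — no Prop. 4.1.1 (2) input needed. [folklore] -/
theorem hsupp_ofNFPoint {ℓ : ℕ} {S : Finset ℕ} (hS : S ⊆ ({2, 3, 5, ℓ} : Finset ℕ)) (hSp : ∀ p ∈ S, p.Prime) :
    ∀ v ∈ badPlaces P, residueChar P.F v ∉ ({2, 3, 5, ℓ} : Finset ℕ) → v ∈ (TateDivisorDatum.ofNFPoint P S).V :=
  fun v hv hres => (TateDivisorDatum.mem_ofNFPoint_V P S v).2 ⟨hv, fun p hp hmem => hres (by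
    rw [(natCast_mem_asIdeal_iff_residueChar_eq v (hSp p hp)).1 hmem]
    exact hS hp)⟩

/-- The instance `S = {2, ℓ}` (Joshi's Tate divisor, p440894 `ofNFPoint λ {2,ℓ}`). [folklore] -/
theorem hsupp_ofNFPoint_pair {ℓ : ℕ} (hℓ : ℓ.Prime) :
    ∀ v ∈ badPlaces P, residueChar P.F v ∉ ({2, 3, 5, ℓ} : Finset ℕ) → v ∈ (TateDivisorDatum.ofNFPoint P {2, ℓ}).V :=
  hsupp_ofNFPoint (fun p hp => by simp only [Finset.mem_insert, Finset.mem_singleton] at hp ⊢; tauto) fun p hp => by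
    simp only [Finset.mem_insert, Finset.mem_singleton] at hp
    rcases hp with rfl | rfl <;> [exact Nat.prime_two; exact hℓ]

/-- **Lemma 6.7.1 (2) ⟹ (3) on the genuine theta-division tower**: the residue characteristic of a place of `K` ramified over `ℚ`
divides `30·ℓ`, or lies under `Supp(𝔮_{F_tpd})`, or divides `disc(F_tpd)` (lies under `Supp(d_{F_tpd})`) — i.e. lies in the finite
set `primeFactors(30ℓ) ∪ p(Supp 𝔮_{F_tpd}) ∪ primeFactors(disc F_tpd)`, Joshi's (3) as a `Finset ℕ`. PROVED.
[claim: Joshi2024ATS4, status: disputed] -/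
theorem residueChar_mem_of_ramified (hU : P.InU) (hF : IsThetaField P F) [IsGalois F K] {ℓ : ℕ} (hℓ : ℓ.Prime)
    (hK : letI := thetaCurve_isElliptic hU F
      ((thetaCurve P F).galoisRepTorsion (ℓ : ℤ)).ker ≤ ψ.fieldRange.fixingSubgroup)
    {𝔮tpd : TateDivisorDatum P.F}
    (hsupp : ∀ v ∈ badPlaces P, residueChar P.F v ∉ ({2, 3, 5, ℓ} : Finset ℕ) → v ∈ 𝔮tpd.V)
    (u : HeightOneSpectrum (𝓞 K)) (hram : 2 ≤ u.asIdeal.ramificationIdx ℤ) :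
    residueChar K u ∈ (2 * 3 * 5 * ℓ).primeFactors ∪ 𝔮tpd.V.image (residueChar P.F) ∪ (discr P.F).natAbs.primeFactors := by
  classical
  by_cases hp : residueChar K u ∣ 2 * 3 * 5 * ℓ
  · exact Finset.mem_union_left _ (Finset.mem_union_left _
      (Nat.mem_primeFactors.mpr ⟨residueChar_prime K u, hp, by have := hℓ.pos; positivity⟩))
  rcases ramified_descends ψ hU hF hℓ hK hsupp u hram hp with hbad | hram₀
  · refine Finset.mem_union_left _ (Finset.mem_union_right _ (Finset.mem_image.mpr ⟨_, hbad, ?_⟩))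
    rw [residueChar_finBelow]
  · have h := residueChar_mem_primeFactors_discr (finBelow P.F K u) hram₀
    rw [residueChar_finBelow] at h
    exact Finset.mem_union_right _ h

end GenuineVdst

/-! ## 4. Both rows at the genuine theta-division tower, `V^dst_ℚ` read by Lemma 6.7.1 (3); and by the §6.6 definition -/

section ThetaTower

variable {P : NFPoint} {F : Type} [Field F] [NumberField F] [Algebra P.F F]
variable {K : Type} [Field K] [NumberField K] [Algebra F K] (ψ : K →ₐ[F] AlgebraicClosure F)
variable [Algebra P.F K] [IsScalarTower P.F F K]

/-- **Row Y-21e DERIVED on the genuine theta-division tower, `V^dst_ℚ` READ BY Lemma 6.7.1 (3)** — `primeFactors(30ℓ) ∪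
p(Supp 𝔮_{F_tpd}) ∪ primeFactors(disc F_tpd)` —: for `λ ∈ U_X`, `F` a theta field, `K/F` Galois inside `F(E_F[ℓ])`, `ℓ` prime,
`𝔮_{F_tpd}` containing the bad places of residue characteristic `∉ {2,3,5,ℓ}` (Joshi's `ofNFPoint λ {2,ℓ}`: `hsupp_ofNFPoint_pair`),
`𝔮_F` supported over `Supp(𝔮_{F_tpd})` (Joshi's `ofNFPointOver λ {2,ℓ} F`: `TateDivisorDatum.mem_ofNFPointOver_V_iff`), and the
carrier's `d_{L′}`-, `q`-, `s`-slots read genuinely at `K`, `𝔮_F`, E-t31's §6.7 objects: `ComponentSums` HOLDS — conjunct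
`d_{L′}` by Lemma 6.7.1 (2) ⟹ (3) (`GenuineVdst.residueChar_mem_of_ramified`), conjunct `q` by definition of (3), the `s`-conjuncts
by (6.7.2)/(6.7.6). PROVED; inputs: tree theorems only. [claim: Joshi2024ATS4, status: disputed] -/
theorem LocusVolumeDatum.componentSums_thetaTower (d : LocusVolumeDatum) {T : PrimeTowerDatum}
    (GT : PrimeTowerDatum.TowerGlue T d) (hU : P.InU) (hF : IsThetaField P F) [IsGalois F K] {ℓ : ℕ} (hℓ : ℓ.Prime)
    (hK : letI := thetaCurve_isElliptic hU F
      ((thetaCurve P F).galoisRepTorsion (ℓ : ℤ)).ker ≤ ψ.fieldRange.fixingSubgroup)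
    {𝔮tpd : TateDivisorDatum P.F}
    (hsupp : ∀ v ∈ badPlaces P, residueChar P.F v ∉ ({2, 3, 5, ℓ} : Finset ℕ) → v ∈ 𝔮tpd.V)
    (𝔮F : TateDivisorDatum F) (hVF : ∀ w ∈ 𝔮F.V, finBelow P.F F w ∈ 𝔮tpd.V)
    (hVdst : d.Vdst = (2 * 3 * 5 * ℓ).primeFactors ∪ 𝔮tpd.V.image (residueChar P.F) ∪ (discr P.F).natAbs.primeFactors)
    (DK : Finset (HeightOneSpectrum (𝓞 K))) (hDK : ∀ u, differentDivisor K (Sum.inr u) ≠ 0 → u ∈ DK)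
    (hDiff : d.logDiffLp = logDifferent K)
    (hDiffAt : ∀ p ∈ d.Vdst, d.logDiffLpAt p =
      (Module.finrank ℚ K : ℝ)⁻¹ * ∑ u ∈ DK with residueChar K u = p, differentDivisor K (Sum.inr u) * logNorm K u)
    (hq : d.logq = 𝔮F.logq)
    (hqAt : ∀ p ∈ d.Vdst, d.logqAt p =
      (Module.finrank ℚ F : ℝ)⁻¹ * ∑ w ∈ 𝔮F.V with residueChar F w = p, 𝔮F.tateDivisor (Sum.inr w) * logNorm F w) :
    d.ComponentSums :=
  d.componentSums_of_genuine GT 𝔮F DK hDK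
    (fun u hu => hVdst ▸ GenuineVdst.residueChar_mem_of_ramified ψ hU hF hℓ hK hsupp u hu)
    (fun w hw => by
      rw [hVdst]
      exact Finset.mem_union_left _ (Finset.mem_union_right _
        (Finset.mem_image.mpr ⟨finBelow P.F F w, hVF w hw, residueChar_finBelow w⟩)))
    hDiff hDiffAt hq hqAt

omit [Algebra F K] [Algebra P.F K] [IsScalarTower P.F F K] [NumberField K] in
/-- **Row Y-21c DERIVED at genuine readings, `V^dst_ℚ` READ BY Lemma 6.7.1 (3)**: E-t4's places `w ∈ W` ARE places of
`Supp(𝔮_F) = V^{odd,ss}` (an indexing `ι : W → Supp(𝔮_F)`), `𝔮_F` is supported over `Supp(𝔮_{F_tpd})`, and the hull slots are read as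
in `eq6111_of_genuine`; then (6.11.1) HOLDS — NO tower / ramification input at all: under reading (3) row c is DEFINITIONAL.
PROVED. [claim: Joshi2024ATS4, status: disputed] -/
theorem LocusVolumeDatum.eq6111_thetaTower (d : LocusVolumeDatum) {lstar : ℕ} {W : Type} [Fintype W]
    {D : SecondMainBoundDatum lstar W} (G : DescentGlue D d) {ℓ : ℕ} {𝔮tpd : TateDivisorDatum P.F} (𝔮F : TateDivisorDatum F)
    (hVF : ∀ w ∈ 𝔮F.V, finBelow P.F F w ∈ 𝔮tpd.V)
    (hVdst : d.Vdst = (2 * 3 * 5 * ℓ).primeFactors ∪ 𝔮tpd.V.image (residueChar P.F) ∪ (discr P.F).natAbs.primeFactors)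
    (ι : W → HeightOneSpectrum (𝓞 F)) (hι : ∀ w, ι w ∈ 𝔮F.V)
    (hAt : ∀ p ∈ d.Vdst, d.logVolAt p =
      ∑ w ∈ Finset.univ with residueChar F (ι w) = p, |Real.log (D.std.loc w).hullVol|)
    (hArch : d.logVolArch = 0) : d.Eq6111 :=
  d.eq6111_of_genuine G (fun w => residueChar F (ι w)) (fun w => by
      rw [hVdst]
      exact Finset.mem_union_left _ (Finset.mem_union_right _
        (Finset.mem_image.mpr ⟨finBelow P.F F (ι w), hVF _ (hι w), residueChar_finBelow (ι w)⟩)))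
    hAt hArch

omit [Algebra P.F F] [Algebra P.F K] [IsScalarTower P.F F K] [NumberField F] in
/-- **Row Y-21e under the §6.6 DEFINITION of `V^dst_ℚ`** (= Lemma 6.7.1 (1)/(2): the primes ramified in `L′ = K`, as the `Finset`
`primeFactors(disc K)`): the `d_{L′}`-conjunct is DERIVED (Dedekind, `GenuineVdst.residueChar_mem_primeFactors_discr`); what the
`q`-conjunct needs is EXACTLY Joshi's Lemma 6.7.1 (4) ⟹ (2) «every prime under `Supp(q_L)` ramifies in `L′`», the hypothesis `h412`
kept BY NAME (the tree proves it in [IUTchI] Def. 3.1 currency: `ThetaData.one_lt_absRamificationIdx_of_under_mem_VFbad`;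
arithmetic of the curve, not bookkeeping). PROVED AS AN IMPLICATION. [claim: Joshi2024ATS4, status: disputed] -/
theorem LocusVolumeDatum.componentSums_of_genuine_defn (d : LocusVolumeDatum) {T : PrimeTowerDatum}
    (GT : PrimeTowerDatum.TowerGlue T d) {L : Type*} [Field L] [NumberField L] (𝔮 : TateDivisorDatum L)
    (hVdst : d.Vdst = (discr K).natAbs.primeFactors)
    (h412 : ∀ w ∈ 𝔮.V, ∃ u : HeightOneSpectrum (𝓞 K), residueChar K u = residueChar L w ∧ 2 ≤ u.asIdeal.ramificationIdx ℤ)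
    (DK : Finset (HeightOneSpectrum (𝓞 K))) (hDK : ∀ u, differentDivisor K (Sum.inr u) ≠ 0 → u ∈ DK)
    (hDiff : d.logDiffLp = logDifferent K)
    (hDiffAt : ∀ p ∈ d.Vdst, d.logDiffLpAt p =
      (Module.finrank ℚ K : ℝ)⁻¹ * ∑ u ∈ DK with residueChar K u = p, differentDivisor K (Sum.inr u) * logNorm K u)
    (hq : d.logq = 𝔮.logq)
    (hqAt : ∀ p ∈ d.Vdst, d.logqAt p =
      (Module.finrank ℚ L : ℝ)⁻¹ * ∑ w ∈ 𝔮.V with residueChar L w = p, 𝔮.tateDivisor (Sum.inr w) * logNorm L w) :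
    d.ComponentSums :=
  d.componentSums_of_genuine GT 𝔮 DK hDK
    (fun u hu => hVdst ▸ GenuineVdst.residueChar_mem_primeFactors_discr u hu)
    (fun w hw => by
      obtain ⟨u, hu, hram⟩ := h412 w hw
      rw [hVdst, ← hu]
      exact GenuineVdst.residueChar_mem_primeFactors_discr u hram)
    hDiff hDiffAt hq hqAt

/-- **The two readings compared on the tower: (1)/(2) ⊆ (3)** — `primeFactors(disc K) ⊆ primeFactors(30ℓ) ∪ p(Supp 𝔮_{F_tpd}) ∪
primeFactors(disc F_tpd)` (Lemma 6.7.1 (2) ⟹ (3) in `Finset` form; the converse inclusion (3) ⟹ (2) is Lemma 6.7.1 (4) ⟹ (2) plus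
«`30ℓ` ramifies in `L′ ⊇ ℚ(ζ_{60ℓ})`», not proved here). PROVED. [claim: Joshi2024ATS4, status: disputed] -/
theorem GenuineVdst.primeFactors_discr_subset (hU : P.InU) (hF : IsThetaField P F) [IsGalois F K] {ℓ : ℕ} (hℓ : ℓ.Prime)
    (hK : letI := thetaCurve_isElliptic hU F
      ((thetaCurve P F).galoisRepTorsion (ℓ : ℤ)).ker ≤ ψ.fieldRange.fixingSubgroup)
    {𝔮tpd : TateDivisorDatum P.F}
    (hsupp : ∀ v ∈ badPlaces P, residueChar P.F v ∉ ({2, 3, 5, ℓ} : Finset ℕ) → v ∈ 𝔮tpd.V) :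
    (discr K).natAbs.primeFactors ⊆
      (2 * 3 * 5 * ℓ).primeFactors ∪ 𝔮tpd.V.image (residueChar P.F) ∪ (discr P.F).natAbs.primeFactors := by
  intro p hp
  have hpp : p.Prime := Nat.prime_of_mem_primeFactors hp
  obtain ⟨u, hu, hram⟩ := exists_two_le_ramificationIdx_of_dvd_discr K hpp
    (Int.natCast_dvd.mpr (Nat.dvd_of_mem_primeFactors hp))
  rw [← hu]
  exact GenuineVdst.residueChar_mem_of_ramified ψ hU hF hℓ hK hsupp u hram

end ThetaTower

end Summit.ABC.IUTFork.Joshi.ATS4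

end
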